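import Summits.Ventures.PercRepro.S1FiveCircuitsThroughChoose

/-!
# PercRepro — THE SPREAD `s₅` CHAIN, MODULO ITS PER-POINT TABLE: `s₅ ≤ Σ_{j ≤ d} q j` AND `s₅ ≤ ⌊n·B/(n − 5)⌋` INSIDE THE SPREAD
CLASS (p1, gen 33)

`proofs/P1-S2-CORANK6.md` §4j. The `s₄` machinery of `S1CoreCapSpreadChain` transposed to the five-circuits (p2's split
`ncard_fiveCircuits_le_through_add_delete` and averaging `exists_nonColoop_ncard_fiveCircuitsThrough_le`, S1FiveCircuitChain):
* **`ncard_fiveCircuits_le_sum_of_perPoint_hereditary`** — p3's deletion recursion for `s₅` inside a deletion-closed class `P`: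
  if every e-free core of nullity `j` in `P` has at most `q j` five-circuits through each point, an e-free core of nullity `d` in `P`
  has `s₅ ≤ Σ_{j ≤ d} q j`;
* **`ncard_fiveCircuits_le_capSum_spread_of`** — the instance `P = spread` (`¬h4`, deletion-closed by `spread_delete`): the per-point
  SPREAD table `q` (the search's `Q₅*_spread(1 … 5) = 1, 5, 15, q₄, q₅`, §4j — NOT typed here: it is the hypothesis) gives
  `s₅ ≤ capSum q d`;
* **`ncard_fiveCircuits_sub_div_le_of_nonColoops_spread`** — the averaging recursion with an explicit count of non-coloops inside
  the spread class: `s₅ − ⌊5·s₅/m⌋ ≤ B` whenever every spread core of nullity `d` has `s₅ ≤ B`;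
* **`ncard_fiveCircuits_le_mul_div_spread_of`** — hence `s₅ ≤ ⌊n·B/(n − 5)⌋` on a coloop-free spread core of nullity `d + 1` on `n`
  points (`le_mul_div_of_sub_div_le_five`), the cell form: at `(13, 6)` with `B = Σ_{j ≤ 5} q j` it reads `⌊19·B/14⌋`;
* **`ncard_fiveCircuits_le_of_perPoint_four_five`** — the table with its first entries filled by the theorem
  `ncard_fiveCircuitsThrough_le_choose` (`1, 5, 15` at nullity `1, 2, 3`, and `C(j + 3, 4)` beyond `5`): on a spread e-free core of nullity `5`,
  `s₅ ≤ 21 + q₄ + q₅` whenever every spread e-free core of nullity `4` (resp. `5`) has at most `q₄` (resp. `q₅`) five-circuits through each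
  point — and **`ncard_fiveCircuits_le_thirteen_six_of_perPoint_four_five`**: on the `(13, 6)` coloop-free spread core,
  `s₅ ≤ ⌊19·(21 + q₄ + q₅)/14⌋` (with `q₄ + q₅ ≤ 46` this is `≤ 90`, what the rows `t ≤ 3` of S2 §(ag) need — §4j).
Nothing here is a cap by itself: the two per-point bounds at nullity `4` and `5` are the hypotheses (the kernel work of §4j).
Axioms: standard.
-/

open scoped Matroid

namespace PercRepro

namespace S1

open Set

open FourCap

variable {α : Type}

/-- **The deletion recursion for the five-circuits inside a deletion-closed class** `P` of e-free cores (p3's recursion, p2's split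
`ncard_fiveCircuits_le_through_add_delete`): if every e-free core of nullity `j` in the class has at most `q j` five-circuits through
each point, an e-free core of nullity `d` in the class has at most `Σ_{j ≤ d} q j`. -/
theorem ncard_fiveCircuits_le_sum_of_perPoint_hereditary (P : Matroid α → Prop)
    (hP : ∀ (M : Matroid α) (x : α), P M → P (M ＼ {x})) (q : ℕ → ℕ)
    (hq : ∀ (M' : Matroid α) [M'.Finite],
      (∀ e ∈ M'.E, ∃ A ⊆ M'.E \ {e}, e ∉ M'.closure A ∧ e ∉ M'.closure ((M'.E \ {e}) \ A)) → P M' →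
      ∀ j : ℕ, M'.E.encard = M'.eRank + j → ∀ e ∈ M'.E,
      {C : Set α | M'.IsCircuit C ∧ C.ncard = 5 ∧ e ∈ C}.ncard ≤ q j)
    (M : Matroid α) [M.Finite]
    (hfree : ∀ e ∈ M.E, ∃ A ⊆ M.E \ {e}, e ∉ M.closure A ∧ e ∉ M.closure ((M.E \ {e}) \ A)) (hPM : P M)
    {d : ℕ} (hd : M.E.encard = M.eRank + d) :
    {C : Set α | M.IsCircuit C ∧ C.ncard = 5}.ncard ≤ (Finset.range (d + 1)).sum q := by
  suffices H : ∀ n : ℕ, ∀ (M : Matroid α) [M.Finite], M.E.ncard = n →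
      (∀ e ∈ M.E, ∃ A ⊆ M.E \ {e}, e ∉ M.closure A ∧ e ∉ M.closure ((M.E \ {e}) \ A)) → P M →
      ∀ d : ℕ, M.E.encard = M.eRank + d →
      {C : Set α | M.IsCircuit C ∧ C.ncard = 5}.ncard ≤ (Finset.range (d + 1)).sum q from
    H _ M rfl hfree hPM d hd
  intro n
  induction n using Nat.strong_induction_on with
  | _ n ih =>
  intro M _ hn hfree hPM d hd
  classical
  set S := {C : Set α | M.IsCircuit C ∧ C.ncard = 5} with hS
  by_cases hSe : S = ∅
  · rw [hSe, ncard_empty]; exact Nat.zero_le _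
  obtain ⟨C₀, hC₀⟩ := nonempty_iff_ne_empty.2 hSe
  obtain ⟨e, heC₀⟩ := hC₀.1.nonempty
  have heE : e ∈ M.E := hC₀.1.subset_ground heC₀
  have hne : ¬ M.IsColoop e := hC₀.1.not_isColoop_of_mem heC₀
  have hν : M✶.eRank = (d : ℕ∞) := by
    have h := _root_.Matroid.eRank_add_eRank_dual M
    rw [hd] at h
    exact WithTop.add_left_cancel (PercRepro.Matroid.eRank_ne_top_of_finite M) h
  have hdel := PercRepro.Matroid.dual_eRank_delete_singleton_add_one heE hne
  rw [hν] at hdel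
  have hfin' : (M ＼ {e})✶.eRank ≠ ⊤ := by
    intro h
    rw [h] at hdel
    exact absurd hdel (by simp)
  obtain ⟨d', hd'⟩ := ENat.ne_top_iff_exists.1 hfin'
  have hdd' : d = d' + 1 := by
    rw [← hd'] at hdel
    exact_mod_cast hdel.symm
  have hd'enc : (M ＼ {e}).E.encard = (M ＼ {e}).eRank + d' := by
    have h := _root_.Matroid.eRank_add_eRank_dual (M ＼ {e})
    rw [← hd'] at h
    exact h.symm
  have hdelE : (M ＼ {e}).E.ncard < n := by
    rw [_root_.Matroid.delete_ground, ← hn, ← ncard_sdiff_singleton_add_one heE M.ground_finite]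
    omega
  have hfree' := S1.hfree_delete M hfree e
  have hsplit := S1.ncard_fiveCircuits_le_through_add_delete M e
  rw [← hS] at hsplit
  have h1 := hq M hfree hPM d hd e heE
  have h2 := ih _ hdelE (M ＼ {e}) rfl hfree' (hP M e hPM) d' hd'enc
  subst hdd'
  rw [Finset.sum_range_succ]
  have h2' : {C : Set α | (M ＼ {e}).IsCircuit C ∧ C.ncard = 5}.ncard ≤ ∑ x ∈ Finset.range (d' + 1), q x := h2
  omega

/-- **The spread `s₅` chain modulo its per-point table**: if every SPREAD e-free core of nullity `j` has at most `q j` five-circuits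
through each point (the hypothesis `hq`), every spread e-free core of nullity `d` has `s₅ ≤ capSum q d = Σ_{j ≤ d} q j`. -/
theorem ncard_fiveCircuits_le_capSum_spread_of (M : Matroid α) [M.Finite]
    (hfree : ∀ e ∈ M.E, ∃ A ⊆ M.E \ {e}, e ∉ M.closure A ∧ e ∉ M.closure ((M.E \ {e}) \ A))
    (hns : ¬ ∃ W ⊆ M.E, W.ncard ≤ 9 ∧ W.encard = M.eRk W + 4)
    {d : ℕ} (hd : M.E.encard = M.eRank + d) (q : ℕ → ℕ)
    (hq : ∀ (M' : Matroid α) [M'.Finite],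
      (∀ e ∈ M'.E, ∃ A ⊆ M'.E \ {e}, e ∉ M'.closure A ∧ e ∉ M'.closure ((M'.E \ {e}) \ A)) →
      (¬ ∃ W ⊆ M'.E, W.ncard ≤ 9 ∧ W.encard = M'.eRk W + 4) →
      ∀ j : ℕ, M'.E.encard = M'.eRank + j → ∀ e ∈ M'.E,
      {C : Set α | M'.IsCircuit C ∧ C.ncard = 5 ∧ e ∈ C}.ncard ≤ q j) :
    {C : Set α | M.IsCircuit C ∧ C.ncard = 5}.ncard ≤ capSum q d :=
  ncard_fiveCircuits_le_sum_of_perPoint_hereditary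
    (fun M' => ¬ ∃ W ⊆ M'.E, W.ncard ≤ 9 ∧ W.encard = M'.eRk W + 4)
    (fun M' x h => spread_delete M' h x) q hq M hfree hns hd

open Classical in
/-- **The averaging recursion for `s₅` with an explicit count of non-coloops, inside the spread class**: on a spread core of nullity
`d + 1` with at least `m ≥ 1` non-coloops, if every SPREAD core of nullity `d` has `s₅ ≤ B`, then `s₅ − ⌊5·s₅/m⌋ ≤ B`. -/
theorem ncard_fiveCircuits_sub_div_le_of_nonColoops_spread (M : Matroid α) [M.Finite]
    (hfree : ∀ e ∈ M.E, ∃ A ⊆ M.E \ {e}, e ∉ M.closure A ∧ e ∉ M.closure ((M.E \ {e}) \ A))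
    (hns : ¬ ∃ W ⊆ M.E, W.ncard ≤ 9 ∧ W.encard = M.eRk W + 4)
    {d : ℕ} (hd : M.E.encard = M.eRank + (d + 1)) {m : ℕ} (hm0 : 0 < m)
    (hm : m ≤ (M.E \ M.coloops).ncard) {B : ℕ}
    (hB : ∀ (M' : Matroid α) [M'.Finite],
      (∀ e ∈ M'.E, ∃ A ⊆ M'.E \ {e}, e ∉ M'.closure A ∧ e ∉ M'.closure ((M'.E \ {e}) \ A)) →
      (¬ ∃ W ⊆ M'.E, W.ncard ≤ 9 ∧ W.encard = M'.eRk W + 4) →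
      M'.E.encard = M'.eRank + d → {C : Set α | M'.IsCircuit C ∧ C.ncard = 5}.ncard ≤ B) :
    {C : Set α | M.IsCircuit C ∧ C.ncard = 5}.ncard -
      5 * {C : Set α | M.IsCircuit C ∧ C.ncard = 5}.ncard / m ≤ B := by
  rcases Nat.eq_zero_or_pos {C : Set α | M.IsCircuit C ∧ C.ncard = 5}.ncard with h0 | hpos
  · rw [h0]; simp
  obtain ⟨x, hxE, hxc, hx⟩ := exists_nonColoop_ncard_fiveCircuitsThrough_le M hpos
  have hm' : m ≤ (M.ground_finite.toFinset.filter (fun x => ¬ M.IsColoop x)).card := by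
    have : (M.ground_finite.toFinset.filter (fun x => ¬ M.IsColoop x) : Set α) = M.E \ M.coloops := by
      ext y; simp only [Finset.coe_filter, Set.Finite.mem_toFinset, mem_setOf_eq, mem_sdiff,
        Matroid.isColoop_iff_mem_coloops]
    rw [← ncard_coe_finset, this]
    exact hm
  have hx' : {C : Set α | M.IsCircuit C ∧ C.ncard = 5 ∧ x ∈ C}.ncard ≤
      5 * {C : Set α | M.IsCircuit C ∧ C.ncard = 5}.ncard / m :=
    hx.trans (Nat.div_le_div_left hm' hm0)
  have hν : M✶.eRank = ((d + 1 : ℕ) : ℕ∞) := by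
    have h := _root_.Matroid.eRank_add_eRank_dual M
    rw [hd] at h
    exact WithTop.add_left_cancel (PercRepro.Matroid.eRank_ne_top_of_finite M) h
  have hdel := PercRepro.Matroid.dual_eRank_delete_singleton_add_one hxE hxc
  rw [hν] at hdel
  have hfin' : (M ＼ {x})✶.eRank ≠ ⊤ := by
    intro h
    rw [h] at hdel
    have h2 : ((d + 1 : ℕ) : ℕ∞) = ⊤ := by rw [← hdel]; simp
    exact ENat.coe_ne_top _ h2
  obtain ⟨d', hd'⟩ := ENat.ne_top_iff_exists.1 hfin'
  have hdd' : d = d' := by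
    rw [← hd'] at hdel
    have : d' + 1 = d + 1 := by exact_mod_cast hdel
    omega
  subst hdd'
  have hd'enc : (M ＼ {x}).E.encard = (M ＼ {x}).eRank + d := by
    have h := _root_.Matroid.eRank_add_eRank_dual (M ＼ {x})
    rw [← hd'] at h
    exact h.symm
  have hB' := hB (M ＼ {x}) (hfree_delete M hfree x) (spread_delete M hns x) hd'enc
  have hsplit := ncard_fiveCircuits_le_through_add_delete M x
  omega

/-- **The spread `s₅` cell cap**: on a coloop-free spread e-free core of nullity `d + 1` on `n > 5` points, if every spread core of
nullity `d` has `s₅ ≤ B`, then `s₅ ≤ ⌊n·B/(n − 5)⌋`. -/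
theorem ncard_fiveCircuits_le_mul_div_spread_of (M : Matroid α) [M.Finite]
    (hfree : ∀ e ∈ M.E, ∃ A ⊆ M.E \ {e}, e ∉ M.closure A ∧ e ∉ M.closure ((M.E \ {e}) \ A))
    (hns : ¬ ∃ W ⊆ M.E, W.ncard ≤ 9 ∧ W.encard = M.eRk W + 4)
    {d : ℕ} (hd : M.E.encard = M.eRank + (d + 1)) {n : ℕ} (hn : M.E.ncard = n) (hn5 : 5 < n)
    (hK : ∀ e, ¬ M.IsColoop e) {B : ℕ}
    (hB : ∀ (M' : Matroid α) [M'.Finite],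
      (∀ e ∈ M'.E, ∃ A ⊆ M'.E \ {e}, e ∉ M'.closure A ∧ e ∉ M'.closure ((M'.E \ {e}) \ A)) →
      (¬ ∃ W ⊆ M'.E, W.ncard ≤ 9 ∧ W.encard = M'.eRk W + 4) →
      M'.E.encard = M'.eRank + d → {C : Set α | M'.IsCircuit C ∧ C.ncard = 5}.ncard ≤ B) :
    {C : Set α | M.IsCircuit C ∧ C.ncard = 5}.ncard ≤ n * B / (n - 5) := by
  have hcol : M.coloops = ∅ := S2.coloops_eq_empty_of_forall_not M hK
  have hm : n ≤ (M.E \ M.coloops).ncard := by rw [hcol, Set.sdiff_empty, hn]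
  have h := ncard_fiveCircuits_sub_div_le_of_nonColoops_spread M hfree hns hd (by omega) hm hB
  exact le_mul_div_of_sub_div_le_five hn5 h

/-- **The per-point table with its first entries filled**: `qFive q₄ q₅ j = C(j + 3, 4)` (`0, 1, 5, 15` at `j ≤ 3`, the theorem
`ncard_fiveCircuitsThrough_le_choose`), `q₄` at `4`, `q₅` at `5`, `C(j + 3, 4)` beyond. -/
def qFive (q₄ q₅ : ℕ) (j : ℕ) : ℕ := if j = 4 then q₄ else if j = 5 then q₅ else (j + 3).choose 4

/-- `Σ_{j ≤ 5} qFive q₄ q₅ j = 21 + q₄ + q₅`. -/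
theorem capSum_qFive_five (q₄ q₅ : ℕ) : capSum (qFive q₄ q₅) 5 = 21 + q₄ + q₅ := by
  simp only [capSum, qFive, Finset.sum_range_succ, Finset.sum_range_zero]
  norm_num [Nat.choose]

/-- **`s₅ ≤ 21 + q₄ + q₅` on every spread e-free core of nullity `5`**, whenever every spread e-free core of nullity `4` has at most `q₄`
five-circuits through each point and every one of nullity `5` at most `q₅` (the entries `1, 5, 15` at nullity `≤ 3` are the theorem). -/
theorem ncard_fiveCircuits_le_of_perPoint_four_five (M : Matroid α) [M.Finite]
    (hfree : ∀ e ∈ M.E, ∃ A ⊆ M.E \ {e}, e ∉ M.closure A ∧ e ∉ M.closure ((M.E \ {e}) \ A))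
    (hns : ¬ ∃ W ⊆ M.E, W.ncard ≤ 9 ∧ W.encard = M.eRk W + 4) (hd : M.E.encard = M.eRank + 5) (q₄ q₅ : ℕ)
    (h4 : ∀ (M' : Matroid α) [M'.Finite],
      (∀ e ∈ M'.E, ∃ A ⊆ M'.E \ {e}, e ∉ M'.closure A ∧ e ∉ M'.closure ((M'.E \ {e}) \ A)) →
      (¬ ∃ W ⊆ M'.E, W.ncard ≤ 9 ∧ W.encard = M'.eRk W + 4) → M'.E.encard = M'.eRank + 4 → ∀ e ∈ M'.E,
      {C : Set α | M'.IsCircuit C ∧ C.ncard = 5 ∧ e ∈ C}.ncard ≤ q₄)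
    (h5 : ∀ (M' : Matroid α) [M'.Finite],
      (∀ e ∈ M'.E, ∃ A ⊆ M'.E \ {e}, e ∉ M'.closure A ∧ e ∉ M'.closure ((M'.E \ {e}) \ A)) →
      (¬ ∃ W ⊆ M'.E, W.ncard ≤ 9 ∧ W.encard = M'.eRk W + 4) → M'.E.encard = M'.eRank + 5 → ∀ e ∈ M'.E,
      {C : Set α | M'.IsCircuit C ∧ C.ncard = 5 ∧ e ∈ C}.ncard ≤ q₅) :
    {C : Set α | M.IsCircuit C ∧ C.ncard = 5}.ncard ≤ 21 + q₄ + q₅ := by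
  have h := ncard_fiveCircuits_le_capSum_spread_of M hfree hns (d := 5) (by exact_mod_cast hd) (qFive q₄ q₅) (by
    intro M' _ hfree' hns' j hj e he
    by_cases h4' : j = 4
    · subst h4'
      simp only [qFive, if_true]
      exact h4 M' hfree' hns' hj e he
    by_cases h5' : j = 5
    · subst h5'
      simp only [qFive, h4', if_false, if_true]
      exact h5 M' hfree' hns' hj e he
    simp only [qFive, h4', h5', if_false]
    exact ncard_fiveCircuitsThrough_le_choose M' hj e)
  rwa [capSum_qFive_five] at h

/-- **THE `(13, 6)` SPREAD `s₅` CAP MODULO THE TWO PER-POINT BOUNDS**: on the coloop-free spread e-free core of nullity `6` on `19` points,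
`s₅ ≤ ⌊19·(21 + q₄ + q₅)/14⌋` (`≤ 90` once `q₄ + q₅ ≤ 46` — S2 §(ag)'s rows `t ≤ 3`). -/
theorem ncard_fiveCircuits_le_thirteen_six_of_perPoint_four_five (M : Matroid α) [M.Finite]
    (hfree : ∀ e ∈ M.E, ∃ A ⊆ M.E \ {e}, e ∉ M.closure A ∧ e ∉ M.closure ((M.E \ {e}) \ A))
    (hns : ¬ ∃ W ⊆ M.E, W.ncard ≤ 9 ∧ W.encard = M.eRk W + 4) (hd : M.E.encard = M.eRank + 6)
    (hn : M.E.ncard = 19) (hK : ∀ e, ¬ M.IsColoop e) (q₄ q₅ : ℕ)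
    (h4 : ∀ (M' : Matroid α) [M'.Finite],
      (∀ e ∈ M'.E, ∃ A ⊆ M'.E \ {e}, e ∉ M'.closure A ∧ e ∉ M'.closure ((M'.E \ {e}) \ A)) →
      (¬ ∃ W ⊆ M'.E, W.ncard ≤ 9 ∧ W.encard = M'.eRk W + 4) → M'.E.encard = M'.eRank + 4 → ∀ e ∈ M'.E,
      {C : Set α | M'.IsCircuit C ∧ C.ncard = 5 ∧ e ∈ C}.ncard ≤ q₄)
    (h5 : ∀ (M' : Matroid α) [M'.Finite],
      (∀ e ∈ M'.E, ∃ A ⊆ M'.E \ {e}, e ∉ M'.closure A ∧ e ∉ M'.closure ((M'.E \ {e}) \ A)) →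
      (¬ ∃ W ⊆ M'.E, W.ncard ≤ 9 ∧ W.encard = M'.eRk W + 4) → M'.E.encard = M'.eRank + 5 → ∀ e ∈ M'.E,
      {C : Set α | M'.IsCircuit C ∧ C.ncard = 5 ∧ e ∈ C}.ncard ≤ q₅) :
    {C : Set α | M.IsCircuit C ∧ C.ncard = 5}.ncard ≤ 19 * (21 + q₄ + q₅) / 14 := by
  have h := ncard_fiveCircuits_le_mul_div_spread_of M hfree hns (d := 5) (by rw [hd]; norm_num) hn (by norm_num) hK
    (B := 21 + q₄ + q₅) (fun M' _ hfree' hns' hd' => ncard_fiveCircuits_le_of_perPoint_four_five M' hfree' hns' hd' q₄ q₅ h4 h5)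
  simpa using h

end S1

end PercRepro
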